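import Mathlib
import HarnessLib

/-!
# R90-TF · S10∕S3 BRIDGE — a kit-indexed character expansion with FINITE FIBRES regroups into a COUNTABLE `(X, a)` expansion with INTEGER
# coefficients (the shape of S3's print-input E-T5a ∕ ★ `R90.S3.endoExpansion_exists_of_countableExpansion_of_finite`)

Cell `hodgecm-mathlib`, crux H413 (`stmt-HodgeConjecture-24833`, lane `--supports … --as helper`), route of record `HCCMUnconditional`; programme R90-TF
(brief `director/R90-BRIEF.v2.md` 1f40d54518340a35); seat R90-C14-p04 (g0), free-hand offer to S10 (R90 bus 16:2xZ; S3 dealer ruling (i) 16:12:57Z: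
«the kit→(X, a) fibre regrouping is the PAYER's (S10) business»).  PURE MATHLIB, generic in the class type `C` and the «trace» functional `T`.
WHAT IT IS FOR.  The E1∕S10 engine letters (★ `Theorems/K2E1TraceFormulaBetaDefs`: `E1St1383Letter`, kit `StGlobKit` = `(Idx, mult, loc, eps)` with laws
COUNTABLE and FIBRE-FINITE) deliver print's (13.8.3) read at `v` as a sum over a countable index of GLOBAL representations, `∑' i, mult i · eps i ·
Tr (loc i v)(φ) = Tr ρ₀(f^H)` [Rogawski1990 §13.8 p. 218–219: «a(π_w) = Σ m(π) ε_π ∈ ℤ», finitely many global `π` over each `π_w`]; S3's socket text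
E-T5a (hypothesis `hE` of ★ `R90S3EndoExpansionOfCountableExpansion`, p861796) wants a countable SET `X` of LOCAL classes with integer coefficients `a : C → ℤ`
chosen BEFORE the test functions.  This file proves that bridge once and for all: with `X := range cls` and `a(π) := Σ_{i : cls i = π} m i` (a finite
sum by FIBRE-FINITE), `X` is countable and for EVERY `T : C → ℂ` with `Σ_i m_i · T(cls i)` summable, `Σ'_{π ∈ X} a(π) · T(π)` is summable with the same sum.
PROOF: transport along `Equiv.sigmaFiberEquiv cls : (Σ π, {i // cls i = π}) ≃ ι`, `Summable.sigma` ∕ `Summable.tsum_sigma` (each fibre sum is the finite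
sum `a(π) · T(π)`), and `tsum_subtype` to pass from all of `C` to `range cls` (off the range every fibre is empty, so `a = 0`).  THEOREMS ONLY (one public
theorem; no `def`, no instance, no notation, no `sorry`).  HONEST LABEL: HC_CM is proved only modulo the 7 printed citations (2 remaining named inputs:
hLiu418 = stmt-HodgeConjecture-24832, h413 = stmt-HodgeConjecture-24833) until rung 0 closes; this file is summation book-keeping and proves no printed
statement by itself.

## References
* [Rogawski1990] J. D. Rogawski, *Automorphic Representations of Unitary Groups in Three Variables*, Ann. of Math. Stud. 123 (1990), §13.8 pp. 218–219
  (display (13.8.3) and «a(π_w) ∈ ℤ»); §12.7 p. 189 (the standing hypotheses on `Σ_{π∈X} a(π) Tr π(f)`: countable `X`, absolute convergence).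
-/

set_option autoImplicit false
-- the mandated namespace repeats the single-problem summit's segment (`HodgeConjecture.HodgeConjecture`)
set_option linter.dupNamespace false

noncomputable section

namespace Summit.HodgeConjecture.HodgeConjecture.R90.S10

/-- **Kit ⇒ countable `(X, a)` expansion (fibre regrouping).**  Let `cls : ι → C` have FINITE FIBRES and `ι` be countable, and let `m : ι → ℤ`.
Then there are a countable `X ⊆ C` (namely `range cls`) and `a : C → ℤ` (namely `a(π) = Σ_{i : cls i = π} m i`) such that for every `T : C → ℂ`
with `Σ_i m_i · T(cls i)` summable, `Σ'_{π ∈ X} a(π) · T(π)` is summable and equals `Σ'_i m_i · T(cls i)`.  At the E1∕S10 kit (`ι := 𝔨.Idx`,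
`m i := mult i · eps i`, `cls i := loc i v`, `T := (·).smoothTrace νQv φ`) this turns an `E1St1383Letter`-shaped engine output [Rogawski1990 §13.8
(13.8.3) p. 218–219, «a(π_w) = Σ m(π)ε_π ∈ ℤ»] into the countable-expansion hypothesis `hE` of ★ `R90.S3.endoExpansion_exists_of_countableExpansion_of_finite`.
[cite: Rogawski1990, §13.8 pp. 218–219; §12.7 p. 189] -/
theorem exists_countableExpansion_of_finite_fibres {ι C : Type*} [Countable ι] (m : ι → ℤ) (cls : ι → C)
    (hfib : ∀ π : C, {i | cls i = π}.Finite) :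
    ∃ (X : Set C) (a : C → ℤ), X.Countable ∧
      ∀ (T : C → ℂ), Summable (fun i => (m i : ℂ) * T (cls i)) →
        Summable (fun π : X => (a π : ℂ) * T π) ∧ ∑' π : X, (a π : ℂ) * T π = ∑' i, (m i : ℂ) * T (cls i) := by
  classical
  refine ⟨Set.range cls, fun π => ∑ i ∈ (hfib π).toFinset, m i, Set.countable_range cls, fun T hT => ?_⟩
  -- transport the summable family to the fibre decomposition `Σ π, {i // cls i = π} ≃ ι`
  have hFe : Summable (fun p : (Σ π : C, {i : ι // cls i = π}) =>
      (m (Equiv.sigmaFiberEquiv cls p) : ℂ) * T (cls (Equiv.sigmaFiberEquiv cls p))) :=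
    (Equiv.sigmaFiberEquiv cls).summable_iff.2 hT
  -- each fibre sum is the FINITE sum `a(π) · T(π)`
  have hfibre : ∀ π : C, ∑' j : {i : ι // cls i = π},
      (m (Equiv.sigmaFiberEquiv cls ⟨π, j⟩) : ℂ) * T (cls (Equiv.sigmaFiberEquiv cls ⟨π, j⟩)) =
        ((∑ i ∈ (hfib π).toFinset, m i : ℤ) : ℂ) * T π := by
    intro π
    have h1 : ∑' j : {i : ι // cls i = π},
        (m (Equiv.sigmaFiberEquiv cls ⟨π, j⟩) : ℂ) * T (cls (Equiv.sigmaFiberEquiv cls ⟨π, j⟩)) =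
          ∑' i, {i | cls i = π}.indicator (fun i => (m i : ℂ) * T (cls i)) i :=
      tsum_subtype {i | cls i = π} (fun i => (m i : ℂ) * T (cls i))
    rw [h1, tsum_eq_sum (s := (hfib π).toFinset) (fun i hi =>
      Set.indicator_of_notMem (fun h => hi ((hfib π).mem_toFinset.2 h)) _)]
    rw [Int.cast_sum, Finset.sum_mul]
    refine Finset.sum_congr rfl fun i hi => ?_
    have hi' : cls i = π := (hfib π).mem_toFinset.1 hi
    rw [Set.indicator_of_mem (show i ∈ {i | cls i = π} from hi'), hi']
  -- hence the fibre sums are summable over `C` with total `Σ'_i m_i · T(cls i)`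
  have hG : Summable (fun π : C => ((∑ i ∈ (hfib π).toFinset, m i : ℤ) : ℂ) * T π) :=
    hFe.sigma.congr hfibre
  have htot : ∑' π : C, ((∑ i ∈ (hfib π).toFinset, m i : ℤ) : ℂ) * T π = ∑' i, (m i : ℂ) * T (cls i) := by
    rw [← (Equiv.sigmaFiberEquiv cls).tsum_eq (fun i => (m i : ℂ) * T (cls i)), hFe.tsum_sigma]
    exact (tsum_congr hfibre).symm
  -- off `range cls` the fibre is empty, so the family vanishes there: restrict to `X = range cls`
  have hsupp : Function.support (fun π : C => ((∑ i ∈ (hfib π).toFinset, m i : ℤ) : ℂ) * T π) ⊆ Set.range cls := by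
    intro π hπ
    by_contra hπ'
    apply hπ
    have h0 : (hfib π).toFinset = ∅ := by
      rw [Set.Finite.toFinset_eq_empty]
      ext i
      simp only [Set.mem_setOf_eq, Set.mem_empty_iff_false, iff_false]
      exact fun h => hπ' ⟨i, h⟩
    simp only [h0, Finset.sum_empty, Int.cast_zero, zero_mul]
  refine ⟨hG.subtype _, ?_⟩
  rw [tsum_subtype (Set.range cls) (fun π => ((∑ i ∈ (hfib π).toFinset, m i : ℤ) : ℂ) * T π),
    Set.indicator_eq_self.2 hsupp, htot]

end Summit.HodgeConjecture.HodgeConjecture.R90.S10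

end
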